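import Literature.Topology.FourManifolds.FlowerDomainPolar
import Literature.Topology.FourManifolds.ThickenedPlanarHandlebody
import HarnessLib

/-!
# Symmetries of the flower surface: rotations about the axis and the reflection

Topic `Literature/Topology/FourManifolds`; fact seat
`provefact-Literature.Topology.FourManifolds.exists-cbed50d78a` (named fact (g′)
`Literature.Topology.FourManifolds.exists_marking_centralSurface_of_gkTrisection`), sequel of
`FlowerHandlebody.lean` / `FlowerDomainPolar.lean`.  The flower `q_g` is invariant under the
rotations by `g`-th roots of unity (`flower_rot`) and under complex conjugation; this file records
the planar reflection `refl` (`q ∘ refl = q`, `refl (pol r θ) = pol r (-θ)`, `refl ∘ rot a =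
rot a⁻¹ ∘ refl`), the rotation of polar points (`rot (exp iα) (pol r θ) = pol r (θ + α)`), and the
**lifts to `ℝ³`** acting on the first two coordinates (`lift3`, the homeomorphisms `rot3 a` and
`refl3`): they preserve the height `p₂`, commute with the projection, preserve every level set
`{q_g(x,y) + z² = c}` of the thickened flower (`thicken_flower_rot3` for `a^g = 1`,
`thicken_flower_refl3`), and carry the slice of a level set over a planar set `W` to the slice
over `rot a (W)` / `refl (W)` (`image_rot3_inter_preimage`, `image_refl3_inter_preimage`) — the
congruence of the `g` sectors of the flower surface and the mirror symmetry of each sector.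
Everything is proved; no named facts.

## References

* D. Gay, R. Kirby, *Trisecting 4-manifolds*, Geom. Topol. 20 (2016), Def. 1, Remark 2.
  [GayKirby2016]
-/

open scoped Manifold ContDiff Topology InnerProductSpace Real
open Set Function Filter Metric Module Complex

noncomputable section

namespace Literature.Topology.FourManifolds

/-- Local notation: `𝔼 n` is the model Euclidean space `EuclideanSpace ℝ (Fin n)`. -/
local notation "𝔼 " n:arg => EuclideanSpace ℝ (Fin n)

open PlanarThickening

namespace FlowerModel

variable {g : ℕ}

/-! ### §1 The planar reflection -/

/-- The reflection `(x, y) ↦ (x, -y)` (complex conjugation). [folklore] -/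
def refl : 𝔼 2 ≃ₗᵢ[ℝ] 𝔼 2 := (toC.trans Complex.conjLIE).trans toC.symm

/-- `toC (refl p) = conj (toC p)`. [folklore] -/
@[simp] theorem toC_refl (p : 𝔼 2) : toC (refl p) = (starRingEnd ℂ) (toC p) := by
  simp [refl, Complex.conjLIE_apply]

/-- `refl` is an involution. [folklore] -/
@[simp] theorem refl_refl (p : 𝔼 2) : refl (refl p) = p := by
  apply toC.injective; rw [toC_refl, toC_refl, Complex.conj_conj]

/-- `refl (pol r θ) = pol r (-θ)`. [folklore] -/
theorem refl_pol (r θ : ℝ) : refl (pol r θ) = pol r (-θ) := by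
  apply toC.injective
  rw [toC_refl, toC_pol, toC_pol, map_mul, Complex.conj_ofReal, ← Complex.exp_conj, map_mul,
    Complex.conj_ofReal, Complex.conj_I]
  push_cast
  ring_nf

/-- `‖refl p‖ = ‖p‖`. [folklore] -/
@[simp] theorem norm_refl (p : 𝔼 2) : ‖refl p‖ = ‖p‖ := refl.norm_map p

/-- The imaginary part of a polar point. [folklore] -/
theorem im_toC_pol (r θ : ℝ) : (toC (pol r θ)).im = r * Real.sin θ := by
  rw [toC_pol, Complex.mul_im, Complex.ofReal_re, Complex.ofReal_im, zero_mul, add_zero,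
    Complex.exp_ofReal_mul_I_im]

/-- The real part of a polar point. [folklore] -/
theorem re_toC_pol (r θ : ℝ) : (toC (pol r θ)).re = r * Real.cos θ := by
  rw [toC_pol, Complex.mul_re, Complex.ofReal_re, Complex.ofReal_im, zero_mul, sub_zero,
    Complex.exp_ofReal_mul_I_re]

/-- The flower is symmetric under the reflection. [folklore] -/
theorem flower_refl (p : 𝔼 2) : flower g (refl p) = flower g p := by
  obtain ⟨θ, -, hp⟩ := exists_eq_pol p
  rw [hp, refl_pol, flower_pol_neg]

/-- Axis points are fixed by the reflection. [folklore] -/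
@[simp] theorem refl_ax (r : ℝ) : refl (ax r) = ax r := by
  rw [← pol_zero_right, refl_pol, neg_zero]

/-- The imaginary part changes sign under the reflection. [folklore] -/
theorem im_toC_refl (p : 𝔼 2) : (toC (refl p)).im = -(toC p).im := by
  rw [toC_refl, Complex.conj_im]

/-- The real part is unchanged under the reflection. [folklore] -/
theorem re_toC_refl (p : 𝔼 2) : (toC (refl p)).re = (toC p).re := by
  rw [toC_refl, Complex.conj_re]

/-- `refl 0 = 0`. [folklore] -/
@[simp] theorem refl_zero : refl (0 : 𝔼 2) = 0 := map_zero refl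

/-! ### §2 Planar rotations -/

/-- `rot 1 = id`. [folklore] -/
@[simp] theorem rot_one (p : 𝔼 2) : rot 1 p = p := by
  apply toC.injective; rw [toC_rot, Circle.coe_one, one_mul]

/-- `rot a (rot b p) = rot (a * b) p`. [folklore] -/
theorem rot_rot (a b : Circle) (p : 𝔼 2) : rot a (rot b p) = rot (a * b) p := by
  apply toC.injective; rw [toC_rot, toC_rot, toC_rot, Circle.coe_mul]; ring

/-- `rot a⁻¹ (rot a p) = p`. [folklore] -/
@[simp] theorem rot_inv_rot (a : Circle) (p : 𝔼 2) : rot a⁻¹ (rot a p) = p := by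
  rw [rot_rot, inv_mul_cancel, rot_one]

/-- `rot a (rot a⁻¹ p) = p`. [folklore] -/
@[simp] theorem rot_rot_inv (a : Circle) (p : 𝔼 2) : rot a (rot a⁻¹ p) = p := by
  rw [rot_rot, mul_inv_cancel, rot_one]

/-- The rotation by the unit complex number `exp(iα)` of a polar point. [folklore] -/
theorem rot_exp_pol (α r θ : ℝ) : rot (Circle.exp α) (pol r θ) = pol r (θ + α) := by
  apply toC.injective
  rw [toC_rot, toC_pol, toC_pol, Circle.coe_exp]
  push_cast
  rw [show ((θ : ℂ) + α) * I = θ * I + α * I by ring, Complex.exp_add]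
  ring

/-- The reflection conjugates a rotation into the inverse rotation. [folklore] -/
theorem refl_rot (a : Circle) (p : 𝔼 2) : refl (rot a p) = rot a⁻¹ (refl p) := by
  apply toC.injective
  rw [toC_refl, toC_rot, toC_rot, toC_refl, map_mul, Circle.coe_inv_eq_conj]

/-! ### §3 The lifts to `ℝ³` -/

/-- The lift of a planar map to `ℝ³`, acting on the first two coordinates. [folklore] -/
def lift3 (f : 𝔼 2 → 𝔼 2) (p : 𝔼 3) : 𝔼 3 := lift (f (proj p)) + p 2 • ez

/-- The projection of the lift. [folklore] -/
@[simp] theorem proj_lift3 (f : 𝔼 2 → 𝔼 2) (p : 𝔼 3) : proj (lift3 f p) = f (proj p) := by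
  rw [lift3, map_add, map_smul, proj_lift, proj_ez, smul_zero, add_zero]

/-- The height of the lift. [folklore] -/
@[simp] theorem lift3_apply_two (f : 𝔼 2 → 𝔼 2) (p : 𝔼 3) : lift3 f p 2 = p 2 := by
  rw [lift3]; simp

/-- Lifts compose. [folklore] -/
theorem lift3_lift3 (f f' : 𝔼 2 → 𝔼 2) (p : 𝔼 3) : lift3 f (lift3 f' p) = lift3 (f ∘ f') p := by
  rw [lift3, proj_lift3, lift3_apply_two, lift3, comp_apply]

/-- The lift of the identity. [folklore] -/
@[simp] theorem lift3_id (p : 𝔼 3) : lift3 id p = p := by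
  rw [lift3, id, lift_proj_add]

/-- The lift of a continuous map is continuous. [folklore] -/
theorem continuous_lift3 {f : 𝔼 2 → 𝔼 2} (hf : Continuous f) : Continuous (lift3 f) := by
  unfold lift3
  exact (lift.continuous.comp (hf.comp proj.continuous)).add
    (((EuclideanSpace.proj (2 : Fin 3)).continuous).smul continuous_const)

/-- The thickening of a planar function at a lifted point. [folklore] -/
theorem thicken_lift3 (q : 𝔼 2 → ℝ) (f : 𝔼 2 → 𝔼 2) (p : 𝔼 3) :
    thicken q (lift3 f p) = q (f (proj p)) + p 2 ^ 2 := by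
  rw [thicken_apply, proj_lift3, lift3_apply_two]

/-- **The lift of a planar bijection pair as a homeomorphism of `ℝ³`.** [folklore] -/
def lift3Homeomorph (f f' : 𝔼 2 → 𝔼 2) (hf : Continuous f) (hf' : Continuous f')
    (h₁ : ∀ u, f' (f u) = u) (h₂ : ∀ u, f (f' u) = u) : 𝔼 3 ≃ₜ 𝔼 3 where
  toFun := lift3 f
  invFun := lift3 f'
  left_inv p := by rw [lift3_lift3, show f' ∘ f = id from funext h₁, lift3_id]
  right_inv p := by rw [lift3_lift3, show f ∘ f' = id from funext h₂, lift3_id]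
  continuous_toFun := continuous_lift3 hf
  continuous_invFun := continuous_lift3 hf'

/-- **The rotation of `ℝ³` about the `z`-axis** by the unit complex number `a`. [folklore] -/
def rot3 (a : Circle) : 𝔼 3 ≃ₜ 𝔼 3 :=
  lift3Homeomorph (rot a) (rot a⁻¹) (rot a).continuous (rot a⁻¹).continuous (rot_inv_rot a) (rot_rot_inv a)

/-- **The reflection of `ℝ³`** in the `xz`-plane. [folklore] -/
def refl3 : 𝔼 3 ≃ₜ 𝔼 3 := lift3Homeomorph refl refl refl.continuous refl.continuous refl_refl refl_refl

/-- `rot3`, evaluated. [folklore] -/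
theorem rot3_apply (a : Circle) (p : 𝔼 3) : rot3 a p = lift (rot a (proj p)) + p 2 • ez := rfl

/-- `refl3`, evaluated. [folklore] -/
theorem refl3_apply (p : 𝔼 3) : refl3 p = lift (refl (proj p)) + p 2 • ez := rfl

/-- The projection of a rotated point. [folklore] -/
@[simp] theorem proj_rot3 (a : Circle) (p : 𝔼 3) : proj (rot3 a p) = rot a (proj p) := proj_lift3 _ p

/-- The height of a rotated point. [folklore] -/
@[simp] theorem rot3_apply_two (a : Circle) (p : 𝔼 3) : rot3 a p 2 = p 2 := lift3_apply_two _ p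

/-- The projection of a reflected point. [folklore] -/
@[simp] theorem proj_refl3 (p : 𝔼 3) : proj (refl3 p) = refl (proj p) := proj_lift3 _ p

/-- The height of a reflected point. [folklore] -/
@[simp] theorem refl3_apply_two (p : 𝔼 3) : refl3 p 2 = p 2 := lift3_apply_two _ p

/-- The inverse rotation. [folklore] -/
theorem rot3_symm_apply (a : Circle) (p : 𝔼 3) : (rot3 a).symm p = rot3 a⁻¹ p := rfl

/-- The reflection is an involution. [folklore] -/
@[simp] theorem refl3_refl3 (p : 𝔼 3) : refl3 (refl3 p) = p := (refl3).left_inv p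

/-- The reflection is its own inverse. [folklore] -/
theorem refl3_symm : (refl3).symm = refl3 := rfl

/-- Rotating a lifted planar point. [folklore] -/
@[simp] theorem rot3_lift (a : Circle) (u : 𝔼 2) : rot3 a (lift u) = lift (rot a u) := by
  rw [rot3_apply, proj_lift, lift_apply_two, zero_smul, add_zero]

/-- Reflecting a lifted planar point. [folklore] -/
@[simp] theorem refl3_lift (u : 𝔼 2) : refl3 (lift u) = lift (refl u) := by
  rw [refl3_apply, proj_lift, lift_apply_two, zero_smul, add_zero]

/-- **Rotations by `g`-th roots of unity preserve the flower surface** (and every level set of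
the thickened flower). [folklore] -/
theorem thicken_flower_rot3 {a : Circle} (ha : (a : ℂ) ^ g = 1) (p : 𝔼 3) :
    thicken (flower g) (rot3 a p) = thicken (flower g) p := by
  rw [rot3, lift3Homeomorph, Homeomorph.homeomorph_mk_coe, Equiv.coe_fn_mk, thicken_lift3,
    flower_rot ha, thicken_apply]

/-- **The reflection preserves the flower surface.** [folklore] -/
theorem thicken_flower_refl3 (p : 𝔼 3) : thicken (flower g) (refl3 p) = thicken (flower g) p := by
  rw [refl3, lift3Homeomorph, Homeomorph.homeomorph_mk_coe, Equiv.coe_fn_mk, thicken_lift3,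
    flower_refl, thicken_apply]

/-- The image of a level set sliced over a planar set under a symmetric rotation. [folklore] -/
theorem image_rot3_inter_preimage {a : Circle} (ha : (a : ℂ) ^ g = 1) (c : ℝ) (W : Set (𝔼 2)) :
    rot3 a '' ({p | thicken (flower g) p = c} ∩ proj ⁻¹' W) =
      {p | thicken (flower g) p = c} ∩ proj ⁻¹' (rot a '' W) := by
  ext p
  constructor
  · rintro ⟨p', ⟨hq, hW⟩, rfl⟩
    refine ⟨?_, ?_⟩
    · show thicken (flower g) (rot3 a p') = c
      rw [thicken_flower_rot3 ha]; exact hq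
    · show proj (rot3 a p') ∈ rot a '' W
      rw [proj_rot3]; exact mem_image_of_mem _ hW
  · rintro ⟨hq, ⟨u, hu, hpu⟩⟩
    refine ⟨(rot3 a).symm p, ⟨?_, ?_⟩, (rot3 a).apply_symm_apply p⟩
    · show thicken (flower g) ((rot3 a).symm p) = c
      rw [← thicken_flower_rot3 ha ((rot3 a).symm p), (rot3 a).apply_symm_apply]; exact hq
    · show proj ((rot3 a).symm p) ∈ W
      rw [rot3_symm_apply, proj_rot3, ← hpu, rot_inv_rot]; exact hu

/-- The image of a level set sliced over a planar set under the reflection. [folklore] -/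
theorem image_refl3_inter_preimage (c : ℝ) (W : Set (𝔼 2)) :
    refl3 '' ({p | thicken (flower g) p = c} ∩ proj ⁻¹' W) =
      {p | thicken (flower g) p = c} ∩ proj ⁻¹' (refl '' W) := by
  ext p
  constructor
  · rintro ⟨p', ⟨hq, hW⟩, rfl⟩
    refine ⟨?_, ?_⟩
    · show thicken (flower g) (refl3 p') = c
      rw [thicken_flower_refl3]; exact hq
    · show proj (refl3 p') ∈ refl '' W
      rw [proj_refl3]; exact mem_image_of_mem _ hW
  · rintro ⟨hq, ⟨u, hu, hpu⟩⟩
    refine ⟨refl3 p, ⟨?_, ?_⟩, refl3_refl3 p⟩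
    · show thicken (flower g) (refl3 p) = c
      rw [thicken_flower_refl3]; exact hq
    · show proj (refl3 p) ∈ W
      rw [proj_refl3, ← hpu, refl_refl]; exact hu

/-- Rotations of `ℝ³` about the `z`-axis preserve the norm. [folklore] -/
theorem norm_rot3 (a : Circle) (p : 𝔼 3) : ‖rot3 a p‖ = ‖p‖ := by
  have h : ∀ q : 𝔼 3, ‖q‖ ^ 2 = ‖proj q‖ ^ 2 + q 2 ^ 2 := fun q => by
    rw [EuclideanSpace.norm_sq_eq, EuclideanSpace.norm_sq_eq, Fin.sum_univ_three, Fin.sum_univ_two,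
      Real.norm_eq_abs, Real.norm_eq_abs, Real.norm_eq_abs, Real.norm_eq_abs, Real.norm_eq_abs,
      sq_abs, sq_abs, sq_abs, sq_abs, sq_abs, proj_apply_zero, proj_apply_one]
  have h1 := h (rot3 a p)
  rw [proj_rot3, rot3_apply_two, norm_rot, ← h p] at h1
  nlinarith [norm_nonneg (rot3 a p), norm_nonneg p, sq_nonneg (‖rot3 a p‖ - ‖p‖), sq_nonneg (‖rot3 a p‖ + ‖p‖)]

end FlowerModel

end Literature.Topology.FourManifolds
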